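import Mathlib
import Summits.NavierStokesRegularity.NavierStokesRegularity.Theorems.TaoLadderRungTwoBreakDSSWaveOfExactFlowDatum
import Summits.NavierStokesRegularity.NavierStokesRegularity.Theorems.TaoLadderRungTwoBreakCircuitTableDefs
import HarnessLib

/-!
# Geometric tail bounds (wake `C_w gⁿ`, top `C_t ϱⁿ` with `ϱΛ < 1`) discharge the summability hypothesis
# of the DSS dictionary — the form in which an interval certificate delivers the shell bounds
# (cell harvest/h2-tao-ladder, seat p2; support for K1(1) = `NoSurvivingDSSOne`, stmt-NavierStokesRegularity-20205)

MODEL lattice ODEs only; nothing about the Navier–Stokes equations; no item closed.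

`DSSOneShift.isDSSWave_of_oneShiftDatum` / `…_of_quadTermDatum` / `…_of_pseudoFlowOnDatum` take shell bounds
`‖x_{-j}‖ ≤ M_j` with the flight budget `Σ_{j∈ℤ} e^{-jT} g^{-j} M_j < ∞` and `M_n ≤ P gⁿ`. A STAGE-2
certificate (`rung1/STAGE2-LEMMA.md` §2) gives exactly: WAKE ball `‖x_{-n}‖ ≤ C_w gⁿ` (physical amplitude
left behind bounded) and TOP ball `‖x_{n}‖ ≤ C_t ϱⁿ` with `ϱ = Γ⁻¹`, `Γ > Λ = g e^{T}`. Then the budget is two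
geometric series: wake terms `C_w e^{-nT}`, top terms `C_t (ϱ g e^{T})ⁿ = C_t (Λ/Γ)ⁿ`
(`summable_flightBudget_of_geometric`), and the end-to-end statements need only the three numbers
`C_w, C_t, ϱ` (`exists_surviving_dssWave_of_pseudoFlowOnDatum_geometric`). Finally
`exists_inTableClass_surviving_dssWave_of_circuitDatum` instantiates everything for the cell's COMPARABLE
CIRCUIT TABLES (`circuitTable`, module `…CircuitTableDefs`): an exact one-shift pseudo-flow of the circuit
lattice with comparable constants and `1 < g² ≤ 1 + ε₀` yields `∃ α, InTableClass R α ∧ ∃ T Φ, IsDSSWave ε₀ α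
(Equiv.refl Unit) T Φ ∧ Surviving 1 ε₀ T ∧ Φ ≢ 0` — literally a counter-instance to the inner statement of
`NoSurvivingDSSOne` at this `(R, ε₀)` (which therefore forces its threshold `ε_s(R) < ε₀`), CONDITIONAL on the
datum that p2's VALIDATED rows assert on paper (T4 at ε₀ ∈ {0.03, 0.05, 0.1, 0.15}, B8 at 0.08; `R = 2/min`).
-/

noncomputable section

-- `Summit.NavierStokesRegularity.NavierStokesRegularity.…` is the tree's (summit = problem) namespace; the
-- duplicated component is intended, so the dupNamespace linter is silenced for this file.
set_option linter.dupNamespace false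

namespace Summit.NavierStokesRegularity.NavierStokesRegularity.Theorems

namespace DSSOneShift

open Filter Topology MeasureTheory Set
open Literature.Analysis.FluidPDE Literature.Analysis.FluidPDE.TaoCascade

variable {m : ℕ}

/-- **Geometric tails ⟹ finite flight budget.**  If `0 ≤ M`, `M_n ≤ C_w gⁿ` (wake) and `M_{-n} ≤ C_t ϱⁿ`
(top) for `n ∈ ℕ`, with `g > 0`, `T > 0`, `0 ≤ ϱ` and `ϱ g e^{T} < 1` (i.e. `ϱ Λ < 1`), then
`Σ_{j∈ℤ} e^{-jT} (g^j)⁻¹ M_j` converges. [folklore (comparison with two geometric series); cell vocabulary, harvest/h2-tao-ladder rung1/STAGE2-LEMMA.md §2 weights] -/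
theorem summable_flightBudget_of_geometric {g T Cw Ct ϱ : ℝ} {M : ℤ → ℝ} (hg : 0 < g) (hT : 0 < T)
    (hϱ : 0 ≤ ϱ) (hϱ1 : ϱ * g * Real.exp T < 1) (hM0 : ∀ j, 0 ≤ M j)
    (hw : ∀ n : ℕ, M n ≤ Cw * g ^ n) (ht : ∀ n : ℕ, M (-(n : ℤ)) ≤ Ct * ϱ ^ n) :
    Summable fun j : ℤ => Real.exp (-((j : ℝ) * T)) * ((g ^ j)⁻¹ * M j) := by
  have hterm0 : ∀ j : ℤ, 0 ≤ Real.exp (-((j : ℝ) * T)) * ((g ^ j)⁻¹ * M j) := fun j =>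
    mul_nonneg (Real.exp_pos _).le (mul_nonneg (inv_nonneg.2 (zpow_pos hg j).le) (hM0 j))
  have hCw : 0 ≤ Cw := by
    have := (hM0 0).trans (hw 0); simpa using this
  have hCt : 0 ≤ Ct := by
    have := (hM0 0).trans (by simpa using ht 0); simpa using this
  refine Summable.of_nat_of_neg ?_ ?_
  · -- wake: `e^{-nT} g^{-n} M_n ≤ C_w (e^{-T})ⁿ`
    have hq : Real.exp (-T) < 1 := by
      rw [← Real.exp_zero]; exact Real.exp_lt_exp.2 (by linarith)
    refine Summable.of_nonneg_of_le (fun n => hterm0 n) (fun n => ?_)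
      ((summable_geometric_of_lt_one (Real.exp_pos _).le hq).mul_left Cw)
    have hgn : 0 < g ^ n := pow_pos hg n
    have h1 : Real.exp (-(((n : ℤ) : ℝ) * T)) = Real.exp (-T) ^ n := by
      rw [← Real.exp_nat_mul]; push_cast; ring_nf
    rw [h1, zpow_natCast]
    calc Real.exp (-T) ^ n * ((g ^ n)⁻¹ * M n)
        ≤ Real.exp (-T) ^ n * ((g ^ n)⁻¹ * (Cw * g ^ n)) := by
          gcongr
          exact hw n
      _ = Cw * Real.exp (-T) ^ n := by field_simp
  · -- top: `e^{nT} gⁿ M_{-n} ≤ C_t (ϱ g e^{T})ⁿ`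
    have hq0 : 0 ≤ ϱ * g * Real.exp T := by positivity
    refine Summable.of_nonneg_of_le (fun n => hterm0 (-(n : ℤ))) (fun n => ?_)
      ((summable_geometric_of_lt_one hq0 hϱ1).mul_left Ct)
    have h1 : Real.exp (-((((-(n : ℤ) : ℤ)) : ℝ) * T)) = Real.exp T ^ n := by
      rw [← Real.exp_nat_mul]; push_cast; ring_nf
    rw [h1, zpow_neg, zpow_natCast, inv_inv]
    calc Real.exp T ^ n * (g ^ n * M (-(n : ℤ)))
        ≤ Real.exp T ^ n * (g ^ n * (Ct * ϱ ^ n)) := by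
          gcongr
          exact ht n
      _ = Ct * (ϱ * g * Real.exp T) ^ n := by rw [mul_pow, mul_pow]; ring

/-- **Exact one-shift pseudo-flow with GEOMETRIC tail bounds ⟹ non-trivial (S₁)-surviving admissible DSS
wave.**  As `exists_surviving_dssWave_of_pseudoFlowOnDatum`, with the shell bounds in certificate form:
`‖x_{-j}(s)‖ ≤ M_j` on `[0, τ]`, `0 ≤ M`, wake `M_n ≤ C_w gⁿ`, top `M_{-n} ≤ C_t ϱⁿ`, `0 ≤ ϱ`, `ϱ g e^{T} < 1`.
[cite: Tao2016AveragedNS, §4 Lemma 4.1, §5.3–§6; cell vocabulary (`PseudoFlowOn`, `IsDSSWave`, `Surviving`), harvest/h2-tao-ladder rung1/STAGE2-LEMMA.md §2–§4] -/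
theorem exists_surviving_dssWave_of_pseudoFlowOnDatum_geometric {ε₀ τ κ₂ g T tstar Cw Ct ϱ : ℝ}
    {M : ℤ → ℝ} {α : Fin m → Fin m → Fin m → ℤ × ℤ × ℤ → ℝ} {S₀ F₀ B₀ : Fin m → ℤ → ℝ}
    {S F : Fin m → ℤ → ℝ → ℝ} (h : PseudoFlowOn τ ε₀ α 0 κ₂ S₀ F₀ B₀ S F)
    (hε : 0 < 1 + ε₀) (hg : 0 < g) (hT : 0 < T) (hlam : bigLam ε₀ = g * Real.exp T) (hτ : 0 < τ)
    (htstar : τ = tstar * (1 - Real.exp (-T)))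
    (hshift : ∀ (i : Fin m) (k : ℤ), g * S i (k + 1) τ = S₀ i k)
    (hM : ∀ (j : ℤ) (s : ℝ), s ∈ Icc 0 τ → ‖shellVec S (-j) s‖ ≤ M j) (hM0 : ∀ j, 0 ≤ M j)
    (hw : ∀ n : ℕ, M n ≤ Cw * g ^ n) (hϱ : 0 ≤ ϱ) (hϱ1 : ϱ * g * Real.exp T < 1)
    (ht : ∀ n : ℕ, M (-(n : ℤ)) ≤ Ct * ϱ ^ n)
    (hg1 : 1 < g ^ 2) (hg2 : g ^ 2 ≤ 1 + ε₀) (hne : ∃ s ∈ Ico 0 τ, ∃ i, S i 0 s ≠ 0) :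
    ∃ Φ : Unit → ℝ → Em m, IsDSSWave ε₀ α (Equiv.refl Unit) T Φ ∧ Surviving 1 ε₀ T ∧
      ∃ x, Φ () x ≠ 0 :=
  exists_surviving_dssWave_of_pseudoFlowOnDatum h hε hg hT hlam hτ htstar hshift hM
    (summable_flightBudget_of_geometric hg hT hϱ hϱ1 hM0 hw ht) hw hg1 hg2 hne

/-- **Circuit instantiation.**  An exact one-shift pseudo-flow of the COMPARABLE CIRCUIT lattice
`circuitTable ρ p q gᵣ k` (positive constants, `ρ ≤ 2`, `p, q, gᵣ, k ≤ 1`, `R⁻¹ ≤` each half-constant) at scale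
ratio `1 + ε₀ > 0`, with renormalisation factor `1 < g² ≤ 1 + ε₀`, `Λ = g e^{T}`, geometric tail bounds and a
non-zero start shell, gives an `R`-comparable table carrying a NON-TRIVIAL (S₁)-SURVIVING admissible DSS wave —
the negation of `NoSurvivingDSSOne`'s inner statement at `(R, ε₀)`.
[cite: Tao2016AveragedNS, §4 (4.1)–(4.3), §5 (circuit), §5.3–§6; cell vocabulary (`InTableClass`, `IsDSSWave`, `Surviving`), harvest/h2-tao-ladder rung1/STAGE2-LEMMA.md] -/
theorem exists_inTableClass_surviving_dssWave_of_circuitDatum {ρ p q gr k R : ℝ}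
    (hρ : 0 < ρ) (hρ1 : ρ ≤ 2) (hp : 0 < p) (hp1 : p ≤ 1) (hq : 0 < q) (hq1 : q ≤ 1)
    (hgr : 0 < gr) (hgr1 : gr ≤ 1) (hk : 0 < k) (hk1 : k ≤ 1) (hRρ : R⁻¹ ≤ ρ / 2) (hRp : R⁻¹ ≤ p / 2)
    (hRq : R⁻¹ ≤ q / 2) (hRg : R⁻¹ ≤ gr / 2) (hRk : R⁻¹ ≤ k / 2)
    {ε₀ τ κ₂ g T tstar Cw Ct ϱ : ℝ} {M : ℤ → ℝ} {S₀ F₀ B₀ : Fin 4 → ℤ → ℝ}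
    {S F : Fin 4 → ℤ → ℝ → ℝ} (h : PseudoFlowOn τ ε₀ (circuitTable ρ p q gr k) 0 κ₂ S₀ F₀ B₀ S F)
    (hε : 0 < 1 + ε₀) (hg : 0 < g) (hT : 0 < T) (hlam : bigLam ε₀ = g * Real.exp T) (hτ : 0 < τ)
    (htstar : τ = tstar * (1 - Real.exp (-T)))
    (hshift : ∀ (i : Fin 4) (k : ℤ), g * S i (k + 1) τ = S₀ i k)
    (hM : ∀ (j : ℤ) (s : ℝ), s ∈ Icc 0 τ → ‖shellVec S (-j) s‖ ≤ M j) (hM0 : ∀ j, 0 ≤ M j)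
    (hw : ∀ n : ℕ, M n ≤ Cw * g ^ n) (hϱ : 0 ≤ ϱ) (hϱ1 : ϱ * g * Real.exp T < 1)
    (ht : ∀ n : ℕ, M (-(n : ℤ)) ≤ Ct * ϱ ^ n)
    (hg1 : 1 < g ^ 2) (hg2 : g ^ 2 ≤ 1 + ε₀) (hne : ∃ s ∈ Ico 0 τ, ∃ i, S i 0 s ≠ 0) :
    ∃ α : Fin 4 → Fin 4 → Fin 4 → ℤ × ℤ × ℤ → ℝ, InTableClass R α ∧
      ∃ (T' : ℝ) (Φ : Unit → ℝ → Em 4), IsDSSWave ε₀ α (Equiv.refl Unit) T' Φ ∧ Surviving 1 ε₀ T' ∧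
        ∃ x, Φ () x ≠ 0 := by
  obtain ⟨Φ, hΦ, hS, hx⟩ := exists_surviving_dssWave_of_pseudoFlowOnDatum_geometric h hε hg hT hlam hτ
    htstar hshift hM hM0 hw hϱ hϱ1 ht hg1 hg2 hne
  exact ⟨circuitTable ρ p q gr k,
    inTableClass_circuitTable hρ hρ1 hp hp1 hq hq1 hgr hgr1 hk hk1 hRρ hRp hRq hRg hRk, T, Φ, hΦ, hS, hx⟩

end DSSOneShift

end Summit.NavierStokesRegularity.NavierStokesRegularity.Theorems
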